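import Mathlib
import HarnessLib
import Summits.HubbardSuperconductivity.HubbardSuperconductivity.Theorems.KLProgrammeKLRegimeEngineTowerBlockStepLev
import Summits.HubbardSuperconductivity.HubbardSuperconductivity.Theorems.KLProgrammeKLRegimeEngineTowerLevBridge
import Summits.HubbardSuperconductivity.HubbardSuperconductivity.Theorems.KLProgrammeKLRegimeEngineTowerBlockIncrWt
import Summits.HubbardSuperconductivity.HubbardSuperconductivity.Theorems.KLProgrammeKLRegimeEngineTowerDoorToKitPrescribed

/-!
# Route `KLProgramme` — crux K3 ENGINE (stmt-HubbardSuperconductivity-20437 `KLRegimeEngineV17F2`), stub (b) v2, THE LEVELS PACKAGE (ℓ):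
# instantiation (I1), LEVELLED TRACKS — the born levelled arrays `klTowerBornLev … d k m F` of a block increment bounded by the KIT's step right side
# (E1-LEVELS-BLUEPRINT-g8 §3 (I1)/§8/§9; the levelled twin of `…TowerBlockIncrWtKit` (k3c3-p2 g13) and `…TowerBlockIncrWtFullKit` (this seat);
#  cell gate-hubbard-kl, seat hubbard-kl-k3c2-p3 g12 as SUBSTITUTE typer while the E1 lineage is unseated — E1 / the kit-dictionary lane may rename or supersede)

E1's `…EngineTowerBlockStepLev` gives the two PRESCRIBED (Hstep) doors at a block step for any even input; this seat's `…EngineTowerLevBridge` (p-landed, g10)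
translates between E1's levelled carrier `klLevNormOf` and the doors' filter forms (input side `doorInput_klTowerInput_le_klTowerMeasLev`, output side
`klLevNormOf_le_of_forall_doorSum_le`), and `…EngineTowerDoorToKitPrescribed` (p641981) dominates the prescribed brackets by the kit's step terms.  Here they are
composed ON THE TOWER'S OWN INCREMENT `Δ_k = klTowerIncr … d k` (input `𝒱_{dk}` read at `F_{dk−1}` in the measured levelled arrays `klTowerMeasLev`, output at
`F_{J′}`, `J′ ≥ dk`):

* §1 `klTowerMeasLev_nonneg`; `prod_sub_mul_pow_le_pow` and **`doorBinomialPrescribedJ_le_towerFO`** — the binomial-prescribed door's LITERAL `J`-form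
  `Σ_{m′} 𝟙[q+1<m′]·((2q+2)!)⁻¹·(Π_{j∉J}(2m′−j))·(2m′)^{|J|}·κ^{2m′−2q−2}·(ρc^{|J|}·ε·B m′ |J|) ≤ (e²)^{q+2}/2·towerFO D κ² N (q+1)` for every leg set `J`;
* §2 **`klLevNormOf_klTowerIncr_le_kit`** — for `1 ≤ d`, `1 ≤ k`, `dk ≤ J′`, `Z^K_{Λ_{dk}} ≠ 0`, the UNWEIGHTED block constants (Gram `κ`, rows/cols `α` of `S(F̃)ᵀΓS(F̃)`,
  overlap `(cr, cc)` of `E(F_{J′})·S(F̃)`, radius `ρ`), a track-blind majorant `N` of the measured levelled input sizes (`27^c·ε·klTowerMeasLev … d k (2m) c ≤ N m`,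
  `N 0 = 0`), a degree cap `D`, kit parameters `τ ≥ (e³κ)², (e²(κ+ρ))²`, `ψ ≥ κ⁻², ρ⁻²` and the kit guard: for EVERY prescription `Ωe` (every level count),
  `klLevNormOf … J′ (2(q+1)) Δ_k Ωe ≤ ε^{2q+1}·(cr·cc^{2q+1}·(Σ_{n∈Icc 2 (N₀−1)} e·Φ^{n−1}·ψ^{q+1}·towerS D τ N n (q+1) + ψ^{q+1}·tail) + cr·cc^{2q+1}·((e²)^{q+2}/2·towerFO D κ² N (q+1)))`
  — the right side is level-FREE once the majorant is track-blind (the level gain lives in the instantiator's choice of `N` and units);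
* §3 **`klTowerBornLev_le_kit`** — at `J′ = dk`, every level count `F`: `klTowerBornLev … d k (2(q+1)) F ≤` the same (the `ciSup` row; an empty level gives `0`).
Compositions of landed theorems; nothing about the model is asserted beyond them; nothing asserts (ℓ), any stub, K3 or superconductivity.
References: BGM 2006 §2.7 (2.71a), §2.8 (2.76)–(2.84), (2.88)–(2.90), §3 (3.2)–(3.8) [cite: BenfattoGiulianiMastropietro2006].
-/

noncomputable section

namespace Summit.HubbardSuperconductivity.HubbardSuperconductivity.Theorems.EngineV8

set_option linter.dupNamespace false -- summit = problem name (single-conjunct summit), D-0017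

open Classical
open Real Finset Literature.MathematicalPhysics.QuantumLattice Literature.Probability.LatticeModels GrassmannAlgebra
open Literature.MathematicalPhysics.QuantumLattice.FermiRG
open Summit.HubbardSuperconductivity.HubbardSuperconductivity.Theorems.KLProgrammeLegKernels
open Summit.HubbardSuperconductivity.HubbardSuperconductivity.Theorems.KLRegimeSplit
open Summit.HubbardSuperconductivity.HubbardSuperconductivity.Theorems.KLRegimeWick
open Summit.HubbardSuperconductivity.HubbardSuperconductivity.Theorems.TwoPointAssembly
open Summit.HubbardSuperconductivity.HubbardSuperconductivity.Theorems.DispersionFlow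
open scoped Nat

/-! ## §1 Elementary rows -/

section Elementary

variable {L M : ℕ} [NeZero L]

/-- The measured levelled size is nonnegative (`0 ≤ β`; an empty level gives the supremum `0`). -/
theorem klTowerMeasLev_nonneg {β : ℝ} (hβ : 0 ≤ β) (U μ : ℝ) (K : TrigPolyC4v) (d k m F : ℕ) : 0 ≤ klTowerMeasLev L M β U μ K d k m F := by
  unfold klTowerMeasLev
  rcases isEmpty_or_nonempty {Ωe : Fin m → Option (SectorLeg (sectorCount (d * k - 1))) // levelCount Ωe = F} with h | h
  · rw [Real.iSup_of_isEmpty]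
  · exact le_ciSup_of_le (Set.finite_range _).bddAbove (Classical.arbitrary _) (klLevNormOf_nonneg hβ μ K _ m _ _)

omit [NeZero L] in
/-- **Falling factors times powers are at most the full power**: for a leg set `J ⊆ Fin (2p)`,
`(Π_{j∉J}(2m′ − j))·(2m′)^{|J|} ≤ (2m′)^{2p}` (cast to `ℝ`). -/
theorem prod_sub_mul_pow_le_pow (p m' : ℕ) (J : Finset (Fin (2 * p))) :
    ((∏ j ∈ univ.filter (fun j : Fin (2 * p) => j ∉ J), (2 * m' - (j : ℕ)) : ℕ) : ℝ) * ((2 * m' : ℕ) : ℝ) ^ J.card ≤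
      ((2 * m' : ℕ) : ℝ) ^ (2 * p) := by
  have hc : (univ.filter (fun j : Fin (2 * p) => j ∉ J)).card + J.card = 2 * p := by
    have h := Finset.card_filter_add_card_filter_not (s := (univ : Finset (Fin (2 * p)))) (fun j => j ∉ J)
    simp only [not_not, Finset.filter_mem_eq_inter, Finset.univ_inter, Finset.card_univ, Fintype.card_fin] at h
    exact h
  rw [Nat.cast_prod]
  calc (∏ j ∈ univ.filter (fun j : Fin (2 * p) => j ∉ J), (((2 * m' - (j : ℕ)) : ℕ) : ℝ)) * ((2 * m' : ℕ) : ℝ) ^ J.card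
      ≤ (∏ _j ∈ univ.filter (fun j : Fin (2 * p) => j ∉ J), ((2 * m' : ℕ) : ℝ)) * ((2 * m' : ℕ) : ℝ) ^ J.card := by
        refine mul_le_mul_of_nonneg_right (prod_le_prod (fun j _ => Nat.cast_nonneg _) fun j _ => ?_) (by positivity)
        exact_mod_cast Nat.sub_le _ _
    _ = ((2 * m' : ℕ) : ℝ) ^ (2 * p) := by rw [prod_const, ← pow_add, hc]

omit [NeZero L] in
/-- **THE BINOMIAL-PRESCRIBED DOOR'S LITERAL `J`-FORM IS DOMINATED BY `towerFO`** (`σ := κ²`): for `κ ≥ 0`, `ρc ≥ 1`, `ε ≥ 0`, `B ≥ 0` with a track-blind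
majorant `N` (`ρc^c·ε·B m′ c ≤ N m′`), `D_Γ ≤ D`, output degree `2(q+1)`, and ANY prescribed leg set `J`:
`Σ_{m′ < D_Γ+1} 𝟙[q+1 < m′]·((2(q+1))!)⁻¹·(Π_{j∉J}(2m′−j))·(2m′)^{|J|}·κ^{2m′−2(q+1)}·(ρc^{|J|}·ε·B m′ |J|) ≤ (e²)^{q+2}/2 · towerFO D κ² N (q+1)`. -/
theorem doorBinomialPrescribedJ_le_towerFO {κ ρc ε : ℝ} (hκ : 0 ≤ κ) (hρc : 0 ≤ ρc) (hε : 0 ≤ ε)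
    {B : ℕ → ℕ → ℝ} (hB0 : ∀ m c, 0 ≤ B m c) {N : ℕ → ℝ} (hNB : ∀ m c, ρc ^ c * (ε * B m c) ≤ N m)
    {DΓ D : ℕ} (hD : DΓ ≤ D) (q : ℕ) (J : Finset (Fin (2 * (q + 1)))) :
    ∑ m' ∈ range (DΓ + 1), (if q + 1 < m' then
        ((((2 * (q + 1)) ! : ℝ))⁻¹ * ((∏ j ∈ univ.filter (fun j : Fin (2 * (q + 1)) => j ∉ J), (2 * m' - (j : ℕ)) : ℕ) : ℝ)) *
          ((2 * m' : ℕ) : ℝ) ^ J.card * κ ^ (2 * m' - 2 * (q + 1)) * (ρc ^ J.card * (ε * B m' J.card)) else 0) ≤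
      exp 2 ^ (q + 2) / 2 * towerFO D (κ ^ 2) N (q + 1) := by
  rw [towerFO, ← sum_filter, mul_sum]
  have hsub : (range (DΓ + 1)).filter (fun m' => q + 1 < m') ⊆ Ioc (q + 1) D := by
    intro m' hm'
    rw [mem_filter, mem_range] at hm'
    rw [mem_Ioc]
    exact ⟨hm'.2, by omega⟩
  refine (sum_le_sum_of_subset_of_nonneg hsub fun m' _ _ => ?_).trans (sum_le_sum fun m' hm' => ?_)
  · exact mul_nonneg (mul_nonneg (mul_nonneg (mul_nonneg (by positivity) (Nat.cast_nonneg _)) (by positivity)) (pow_nonneg hκ _))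
      (mul_nonneg (pow_nonneg hρc _) (mul_nonneg hε (hB0 _ _)))
  · have hlt : q + 1 < m' := (mem_Ioc.1 hm').1
    have hf := inv_factorial_mul_pow_le_choose (p := q + 1) (m' := m') (by omega)
    rw [show q + 1 + 1 = q + 2 by ring] at hf
    have hJ := prod_sub_mul_pow_le_pow (q + 1) m' J
    have hκp : κ ^ (2 * m' - 2 * (q + 1)) = (κ ^ 2) ^ (m' - (q + 1)) := by
      rw [← pow_mul, show 2 * (m' - (q + 1)) = 2 * m' - 2 * (q + 1) by omega]
    rw [hκp]
    have hσ : 0 ≤ (κ ^ 2) ^ (m' - (q + 1)) := by positivity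
    have hfi : 0 ≤ ((((2 * (q + 1)) ! : ℝ))⁻¹) := by positivity
    calc (((2 * (q + 1)) ! : ℝ))⁻¹ * ((∏ j ∈ univ.filter (fun j : Fin (2 * (q + 1)) => j ∉ J), (2 * m' - (j : ℕ)) : ℕ) : ℝ) *
          ((2 * m' : ℕ) : ℝ) ^ J.card * (κ ^ 2) ^ (m' - (q + 1)) * (ρc ^ J.card * (ε * B m' J.card))
        = (((2 * (q + 1)) ! : ℝ))⁻¹ * (((∏ j ∈ univ.filter (fun j : Fin (2 * (q + 1)) => j ∉ J), (2 * m' - (j : ℕ)) : ℕ) : ℝ) *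
          ((2 * m' : ℕ) : ℝ) ^ J.card) * (κ ^ 2) ^ (m' - (q + 1)) * (ρc ^ J.card * (ε * B m' J.card)) := by ring
      _ ≤ (((2 * (q + 1)) ! : ℝ))⁻¹ * ((2 * m' : ℕ) : ℝ) ^ (2 * (q + 1)) * (κ ^ 2) ^ (m' - (q + 1)) * N m' := by
          refine mul_le_mul (mul_le_mul_of_nonneg_right (mul_le_mul_of_nonneg_left hJ hfi) hσ) (hNB _ _)
            (mul_nonneg (pow_nonneg hρc _) (mul_nonneg hε (hB0 _ _))) (by positivity)
      _ ≤ exp 2 ^ (q + 2) / 2 * ((2 * m').choose (2 * (q + 1)) : ℝ) * (κ ^ 2) ^ (m' - (q + 1)) * N m' := by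
          have hN : 0 ≤ N m' := le_trans (mul_nonneg (pow_nonneg hρc _) (mul_nonneg hε (hB0 m' J.card))) (hNB _ _)
          exact mul_le_mul_of_nonneg_right (mul_le_mul_of_nonneg_right hf hσ) hN
      _ = exp 2 ^ (q + 2) / 2 * (((2 * m').choose (2 * (q + 1)) : ℝ) * (κ ^ 2) ^ (m' - (q + 1)) * N m') := by ring

end Elementary

/-! ## §2 Every levelled norm of `Δ_k` in kit form -/

section Born

variable {L M : ℕ} [NeZero L] [NeZero M]

/-- **THE LEVELLED NORMS OF A BLOCK INCREMENT IN KIT FORM, EVERY PRESCRIPTION.**  `1 ≤ d`, `1 ≤ k`, `dk ≤ J′`, `Z^K_{Λ_{dk}} ≠ 0`; UNWEIGHTED block constants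
(Gram `κ`, rows/cols `α`, overlap `(cr, cc)`, radius `ρ`, truncation `N₀ ≥ 2`); a track-blind majorant `N ≥ 0`, `N 0 = 0`, of the measured levelled input sizes
`27^c·ε·klTowerMeasLev … d k (2m) c ≤ N m`; degree cap `D`; kit parameters `τ, ψ`; KIT guard `(eα/κ²)·towerV D τ N < 1`.  Then for every `Ωe`:
`klLevNormOf … J′ (2(q+1)) Δ_k Ωe ≤ ε^{2q+1}·(cr·cc^{2q+1}·(Σ e·Φ^{n−1}·ψ^{q+1}·towerS + ψ^{q+1}·tail) + cr·cc^{2q+1}·((e²)^{q+2}/2·towerFO D κ² N (q+1)))`. -/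
theorem klLevNormOf_klTowerIncr_le_kit {β : ℝ} (hβ : 0 < β) (U μ : ℝ) (K : TrigPolyC4v) {d k J' : ℕ} (hd : 1 ≤ d) (hk : 1 ≤ k) (hJ' : d * k ≤ J')
    (hZ : hubbardEffPartitionFnCT L M β U μ 0 K (klScale klE0 (d * k)) ≠ 0)
    {κ : ℝ} (hκ : 0 < κ)
    (hGB : IsGramBoundedR ((sectorSubMatrix L M β (bgmFatMultiplier L M klE0 β (nambuXiCT L μ K) (d * k - 1))).transpose *
      hubbardCovSliceCT L M β μ 0 K (klScale klE0 (d * (k + 1))) (klScale klE0 (d * k)) *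
        sectorSubMatrix L M β (bgmFatMultiplier L M klE0 β (nambuXiCT L μ K) (d * k - 1))) κ)
    {α : ℝ} (hα : 0 < α)
    (hrow : ∀ X, ∑ Y, ‖((sectorSubMatrix L M β (bgmFatMultiplier L M klE0 β (nambuXiCT L μ K) (d * k - 1))).transpose *
        hubbardCovSliceCT L M β μ 0 K (klScale klE0 (d * (k + 1))) (klScale klE0 (d * k)) *
          sectorSubMatrix L M β (bgmFatMultiplier L M klE0 β (nambuXiCT L μ K) (d * k - 1))) X Y‖ ≤ α)
    (hcol : ∀ Y, ∑ X, ‖((sectorSubMatrix L M β (bgmFatMultiplier L M klE0 β (nambuXiCT L μ K) (d * k - 1))).transpose *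
        hubbardCovSliceCT L M β μ 0 K (klScale klE0 (d * (k + 1))) (klScale klE0 (d * k)) *
          sectorSubMatrix L M β (bgmFatMultiplier L M klE0 β (nambuXiCT L μ K) (d * k - 1))) X Y‖ ≤ α)
    {ρ : ℝ} (hρ : 0 < ρ)
    {cr cc : ℝ} (hcr0 : 0 ≤ cr) (hcc0 : 0 ≤ cc)
    (hrow' : ∀ X'', ∑ X', ‖(sectorAnalysisMatrix L M β (klAnisoFamily L M β μ K klE0 J') *
        sectorSubMatrix L M β (bgmFatMultiplier L M klE0 β (nambuXiCT L μ K) (d * k - 1))) X'' X'‖ ≤ cr)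
    (hcol' : ∀ X', ∑ X'', ‖(sectorAnalysisMatrix L M β (klAnisoFamily L M β μ K klE0 J') *
        sectorSubMatrix L M β (bgmFatMultiplier L M klE0 β (nambuXiCT L μ K) (d * k - 1))) X'' X'‖ ≤ cc)
    {N₀ : ℕ} (hN₀ : 2 ≤ N₀)
    {N : ℕ → ℝ} (hN0 : ∀ m, 0 ≤ N m) (hN00 : N 0 = 0)
    (hNB : ∀ m c, (27 : ℝ) ^ c * (imagTimeWeight β M * klTowerMeasLev L M β U μ K d k (2 * m) c) ≤ N m)
    {D : ℕ} (hD : Fintype.card (SpaceTimeIdx L M × SectorLeg (sectorCount (d * k - 1))) / 2 ≤ D)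
    {τ ψ : ℝ} (hτ1 : (exp 3 * κ) ^ 2 ≤ τ) (hτ2 : (exp 2 * (κ + ρ)) ^ 2 ≤ τ) (hψ1 : κ⁻¹ ^ 2 ≤ ψ) (hψ2 : ρ⁻¹ ^ 2 ≤ ψ)
    (hguard : exp 1 * α / κ ^ 2 * towerV D τ N < 1) (q : ℕ) (Ωe : Fin (2 * q + 1 + 1) → Option (SectorLeg (sectorCount J'))) :
    klLevNormOf L M β μ K J' (2 * q + 1 + 1) (klTowerIncr L M β U μ K d k) Ωe ≤
      imagTimeWeight β M ^ (2 * q + 1) *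
        (cr * cc ^ (2 * q + 1) *
            (∑ n ∈ Icc 2 (N₀ - 1), exp 1 * (exp 1 * α / κ ^ 2) ^ (n - 1) * ψ ^ (q + 1) * towerS D τ N n (q + 1) +
              ψ ^ (q + 1) * (exp 1 * towerV D τ N * (exp 1 * α / κ ^ 2 * towerV D τ N) ^ (N₀ - 1) / (1 - exp 1 * α / κ ^ 2 * towerV D τ N))) +
          cr * cc ^ (2 * q + 1) * (exp 2 ^ (q + 2) / 2 * towerFO D (κ ^ 2) N (q + 1))) := by
  have hβ' : β ≠ 0 := hβ.ne'
  have hJ₁ : 1 ≤ d * k := le_trans hd (Nat.le_mul_of_pos_right d hk)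
  have hJ : d * k ≤ d * (k + 1) := Nat.mul_le_mul_left d (Nat.le_succ k)
  have hε : 0 ≤ imagTimeWeight β M := imagTimeWeight_nonneg hβ.le M
  have h27 : (0 : ℝ) ≤ 27 := by norm_num
  have hG : klTowerInput L M β U μ K d k ∈ evenPart ℂ (HubbardFieldIdx L M) := klEffectiveAction_mem_evenPart hβ' U μ K klE0 (d * k)
  have hG0 : constPart ℂ (klTowerInput L M β U μ K d k) = 0 := constPart_klEffectiveAction_eq_zero β U μ K klE0 (d * k) hZ
  -- abbreviations for the kit terms and their signs
  set Φ := exp 1 * α / κ ^ 2 with hΦ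
  set FO := towerFO D (κ ^ 2) N (q + 1) with hFO
  set S := ∑ n ∈ Icc 2 (N₀ - 1), exp 1 * Φ ^ (n - 1) * ψ ^ (q + 1) * towerS D τ N n (q + 1) with hS
  set T := ψ ^ (q + 1) * (exp 1 * towerV D τ N * (Φ * towerV D τ N) ^ (N₀ - 1) / (1 - Φ * towerV D τ N)) with hT
  have hτ0 : 0 ≤ τ := le_trans (by positivity) hτ1
  have hψ0 : 0 ≤ ψ := le_trans (by positivity) hψ1
  have hΦ0 : 0 ≤ Φ := by rw [hΦ]; positivity
  have hFO0 : 0 ≤ FO := towerFO_nonneg (by positivity) hN0 _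
  have hS0 : 0 ≤ S := sum_nonneg fun n _ => by
    have := towerS_nonneg (D := D) hτ0 hN0 n (q + 1); positivity
  have hT0 : 0 ≤ T := by
    have hV := towerV_nonneg (D := D) hτ0 hN0
    exact mul_nonneg (pow_nonneg hψ0 _) (div_nonneg (by positivity) (sub_nonneg.2 hguard.le))
  have hC0 : 0 ≤ imagTimeWeight β M ^ (2 * q + 1) * (cr * cc ^ (2 * q + 1) * (S + T) + cr * cc ^ (2 * q + 1) * (exp 2 ^ (q + 2) / 2 * FO)) := by
    positivity
  -- the input sizes: measured levelled arrays
  set B : ℕ → ℕ → ℝ := fun m c => klTowerMeasLev L M β U μ K d k (2 * m) c with hB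
  have hB0 : ∀ m c, 0 ≤ B m c := fun m c => klTowerMeasLev_nonneg hβ.le U μ K d k _ c
  have hBin : ∀ (m' Fc : ℕ) (E : Finset (Fin (2 * m' + 1 + 1))) (τ' : Fin (2 * m' + 1 + 1) → SectorLeg (sectorCount (d * k - 1)))
      (q' : Fin (2 * m' + 1 + 1)), q' ∈ E → E.card = Fc + 1 → ∀ y : SpaceTimeIdx L M,
        imagTimeWeight β M ^ (2 * m' + 1) *
          ∑ σ ∈ univ.filter (fun σ : Fin (2 * m' + 1 + 1) → SectorLeg (sectorCount (d * k - 1)) => ∀ e ∈ E, σ e = τ' e),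
            ∑ x ∈ univ.filter (fun x : Fin (2 * m' + 1 + 1) → SpaceTimeIdx L M => x q' = y),
              ‖sectorisedKernel L M β (klAnisoFamily L M β μ K klE0 (d * k - 1)) (klTowerInput L M β U μ K d k) (2 * m' + 1 + 1) σ x‖ ≤ B (m' + 1) Fc :=
    fun m' Fc E τ' q' hq hE y => doorInput_klTowerInput_le_klTowerMeasLev hβ.le U μ K d k m' Fc E τ' q' hq hE y
  have hNB' : ∀ m c, (27 : ℝ) ^ c * (imagTimeWeight β M * B m c) ≤ N m := fun m c => hNB m c
  -- the door guard from the kit guard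
  have hV := normV_prescribed_le_towerV (Γ := SpaceTimeIdx L M × SectorLeg (sectorCount (d * k - 1))) (ρc := (27 : ℝ)) (ε := imagTimeWeight β M)
    hκ.le hρ.le (B := B) hN0 hN00 hNB' hD hτ2
  have hθ : Real.exp 1 * α * normV (SpaceTimeIdx L M × SectorLeg (sectorCount (d * k - 1))) κ ρ
      (fun m' => (27 : ℝ) ^ 0 * (imagTimeWeight β M * B m' 0)) / κ ^ 2 < 1 := by
    calc Real.exp 1 * α * normV (SpaceTimeIdx L M × SectorLeg (sectorCount (d * k - 1))) κ ρ
          (fun m' => (27 : ℝ) ^ 0 * (imagTimeWeight β M * B m' 0)) / κ ^ 2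
        = Φ * normV (SpaceTimeIdx L M × SectorLeg (sectorCount (d * k - 1))) κ ρ (fun m' => (27 : ℝ) ^ 0 * (imagTimeWeight β M * B m' 0)) := by
          rw [hΦ]; ring
      _ ≤ Φ * towerV D τ N := mul_le_mul_of_nonneg_left hV hΦ0
      _ < 1 := hguard
  -- the output bridge: every door-form sum is bounded by the kit right side
  refine klLevNormOf_le_of_forall_doorSum_le hβ.le μ K J' (klTowerIncr L M β U μ K d k) Ωe hC0 fun p s x => ?_
  set J : Finset (Fin (2 * q + 1 + 1)) := univ.filter (fun i : Fin (2 * q + 1 + 1) => (Ωe i).isSome ∧ i ≠ p) with hJdef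
  have hp : p ∉ J := by rw [hJdef, mem_filter]; exact fun h => h.2.2 rfl
  -- the two doors at this (p, J, τ″, w″)
  have h2 := blockStep_ordersGe2_lev_le (L := L) (M := M) hβ μ K hJ₁ hJ hJ' (klTowerInput L M β U μ K d k) hG hG0 hκ hGB B hB0 hBin hα hrow hcol
    hρ hθ hcc0 hrow' hcol' hN₀ (m := 2 * q + 1) p J hp (fun j => (Ωe j).getD s) (x, s)
  have h1 := blockStep_firstOrder_lev_le (L := L) (M := M) hβ μ K hJ₁ hJ hJ' (klTowerInput L M β U μ K d k) hG hκ.le hGB B hB0 hBin hcc0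
    hrow' hcol' (q := q) p J hp (fun j => (Ωe j).getD s) (x, s)
  -- dominate the brackets by the kit terms
  have hgr := doorGradedPrescribed_le_kitStep (Γ := SpaceTimeIdx L M × SectorLeg (sectorCount (d * k - 1))) (Jt := ↥J)
    hκ hρ hα.le h27 hε hB0 hN0 hN00 hNB' hD hN₀ (m := 2 * q + 1) (p := q + 1) (by ring) hτ1 hτ2 hψ1 hψ2 hguard
  rw [Fintype.card_coe] at hgr
  have hfo := doorBinomialPrescribedJ_le_towerFO (κ := κ) (ρc := (27 : ℝ)) (ε := imagTimeWeight β M) hκ.le h27 hε hB0 (N := N) hNB' hD q J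
  have h2' := h2.trans (mul_le_mul_of_nonneg_left hgr (by positivity))
  have h1' := h1.trans (mul_le_mul_of_nonneg_left hfo (by positivity))
  -- split `Δ_k` inside the door-form sum
  rw [klTowerIncr_eq_ordersGe2_add_firstOrder β U μ K d k hZ, map_add]
  have hsplit : ∀ X : Fin (2 * q + 1 + 1) → SpaceTimeIdx L M × SectorLeg (sectorCount J'),
      ‖kernel ℂ (ExteriorAlgebra.map (Matrix.toLin' (sectorAnalysisMatrix L M β (klAnisoFamily L M β μ K klE0 J')))
            (effAction ℂ (hubbardCovSliceCT L M β μ 0 K (klScale klE0 (d * (k + 1))) (klScale klE0 (d * k))) (klTowerInput L M β U μ K d k) -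
              gaussConv ℂ (hubbardCovSliceCT L M β μ 0 K (klScale klE0 (d * (k + 1))) (klScale klE0 (d * k))) (klTowerInput L M β U μ K d k)) +
          ExteriorAlgebra.map (Matrix.toLin' (sectorAnalysisMatrix L M β (klAnisoFamily L M β μ K klE0 J')))
            (gaussConv ℂ (hubbardCovSliceCT L M β μ 0 K (klScale klE0 (d * (k + 1))) (klScale klE0 (d * k))) (klTowerInput L M β U μ K d k) -
              klTowerInput L M β U μ K d k)) (2 * q + 1 + 1) X‖ ≤
        ‖kernel ℂ (ExteriorAlgebra.map (Matrix.toLin' (sectorAnalysisMatrix L M β (klAnisoFamily L M β μ K klE0 J')))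
            (effAction ℂ (hubbardCovSliceCT L M β μ 0 K (klScale klE0 (d * (k + 1))) (klScale klE0 (d * k))) (klTowerInput L M β U μ K d k) -
              gaussConv ℂ (hubbardCovSliceCT L M β μ 0 K (klScale klE0 (d * (k + 1))) (klScale klE0 (d * k))) (klTowerInput L M β U μ K d k)))
            (2 * q + 1 + 1) X‖ +
        ‖kernel ℂ (ExteriorAlgebra.map (Matrix.toLin' (sectorAnalysisMatrix L M β (klAnisoFamily L M β μ K klE0 J')))
            (gaussConv ℂ (hubbardCovSliceCT L M β μ 0 K (klScale klE0 (d * (k + 1))) (klScale klE0 (d * k))) (klTowerInput L M β U μ K d k) -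
              klTowerInput L M β U μ K d k)) (2 * q + 1 + 1) X‖ := fun X => by
    rw [kernel_add]; exact norm_add_le _ _
  calc imagTimeWeight β M ^ (2 * q + 1) * _
      ≤ imagTimeWeight β M ^ (2 * q + 1) * (_ + _) := by
        refine mul_le_mul_of_nonneg_left ((sum_le_sum fun X _ => hsplit X).trans (le_of_eq (sum_add_distrib))) (pow_nonneg hε _)
    _ ≤ imagTimeWeight β M ^ (2 * q + 1) * (cr * cc ^ (2 * q + 1) * (S + T) + cr * cc ^ (2 * q + 1) * (exp 2 ^ (q + 2) / 2 * FO)) :=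
        mul_le_mul_of_nonneg_left (add_le_add h2' h1') (pow_nonneg hε _)

/-! ## §3 The born levelled arrays in kit form -/

/-- **THE BORN LEVELLED ARRAYS OF A BLOCK INCREMENT IN KIT FORM, EVERY LEVEL COUNT** (the `hstep` row of the levelled tracks, model half ∘ dictionary).  At the born
family `J′ = dk` and under the binders of `klLevNormOf_klTowerIncr_le_kit`, for every level count `F`:
`klTowerBornLev … d k (2(q+1)) F ≤ ε^{2q+1}·(cr·cc^{2q+1}·(Σ + tail) + cr·cc^{2q+1}·((e²)^{q+2}/2·towerFO))` (the `ciSup` row; an empty level gives `0 ≤` the same). -/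
theorem klTowerBornLev_le_kit {β : ℝ} (hβ : 0 < β) (U μ : ℝ) (K : TrigPolyC4v) {d k : ℕ} (hd : 1 ≤ d) (hk : 1 ≤ k)
    (hZ : hubbardEffPartitionFnCT L M β U μ 0 K (klScale klE0 (d * k)) ≠ 0)
    {κ : ℝ} (hκ : 0 < κ)
    (hGB : IsGramBoundedR ((sectorSubMatrix L M β (bgmFatMultiplier L M klE0 β (nambuXiCT L μ K) (d * k - 1))).transpose *
      hubbardCovSliceCT L M β μ 0 K (klScale klE0 (d * (k + 1))) (klScale klE0 (d * k)) *
        sectorSubMatrix L M β (bgmFatMultiplier L M klE0 β (nambuXiCT L μ K) (d * k - 1))) κ)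
    {α : ℝ} (hα : 0 < α)
    (hrow : ∀ X, ∑ Y, ‖((sectorSubMatrix L M β (bgmFatMultiplier L M klE0 β (nambuXiCT L μ K) (d * k - 1))).transpose *
        hubbardCovSliceCT L M β μ 0 K (klScale klE0 (d * (k + 1))) (klScale klE0 (d * k)) *
          sectorSubMatrix L M β (bgmFatMultiplier L M klE0 β (nambuXiCT L μ K) (d * k - 1))) X Y‖ ≤ α)
    (hcol : ∀ Y, ∑ X, ‖((sectorSubMatrix L M β (bgmFatMultiplier L M klE0 β (nambuXiCT L μ K) (d * k - 1))).transpose *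
        hubbardCovSliceCT L M β μ 0 K (klScale klE0 (d * (k + 1))) (klScale klE0 (d * k)) *
          sectorSubMatrix L M β (bgmFatMultiplier L M klE0 β (nambuXiCT L μ K) (d * k - 1))) X Y‖ ≤ α)
    {ρ : ℝ} (hρ : 0 < ρ)
    {cr cc : ℝ} (hcr0 : 0 ≤ cr) (hcc0 : 0 ≤ cc)
    (hrow' : ∀ X'', ∑ X', ‖(sectorAnalysisMatrix L M β (klAnisoFamily L M β μ K klE0 (d * k)) *
        sectorSubMatrix L M β (bgmFatMultiplier L M klE0 β (nambuXiCT L μ K) (d * k - 1))) X'' X'‖ ≤ cr)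
    (hcol' : ∀ X', ∑ X'', ‖(sectorAnalysisMatrix L M β (klAnisoFamily L M β μ K klE0 (d * k)) *
        sectorSubMatrix L M β (bgmFatMultiplier L M klE0 β (nambuXiCT L μ K) (d * k - 1))) X'' X'‖ ≤ cc)
    {N₀ : ℕ} (hN₀ : 2 ≤ N₀)
    {N : ℕ → ℝ} (hN0 : ∀ m, 0 ≤ N m) (hN00 : N 0 = 0)
    (hNB : ∀ m c, (27 : ℝ) ^ c * (imagTimeWeight β M * klTowerMeasLev L M β U μ K d k (2 * m) c) ≤ N m)
    {D : ℕ} (hD : Fintype.card (SpaceTimeIdx L M × SectorLeg (sectorCount (d * k - 1))) / 2 ≤ D)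
    {τ ψ : ℝ} (hτ1 : (exp 3 * κ) ^ 2 ≤ τ) (hτ2 : (exp 2 * (κ + ρ)) ^ 2 ≤ τ) (hψ1 : κ⁻¹ ^ 2 ≤ ψ) (hψ2 : ρ⁻¹ ^ 2 ≤ ψ)
    (hguard : exp 1 * α / κ ^ 2 * towerV D τ N < 1) (q F : ℕ) :
    klTowerBornLev L M β U μ K d k (2 * (q + 1)) F ≤
      imagTimeWeight β M ^ (2 * q + 1) *
        (cr * cc ^ (2 * q + 1) *
            (∑ n ∈ Icc 2 (N₀ - 1), exp 1 * (exp 1 * α / κ ^ 2) ^ (n - 1) * ψ ^ (q + 1) * towerS D τ N n (q + 1) +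
              ψ ^ (q + 1) * (exp 1 * towerV D τ N * (exp 1 * α / κ ^ 2 * towerV D τ N) ^ (N₀ - 1) / (1 - exp 1 * α / κ ^ 2 * towerV D τ N))) +
          cr * cc ^ (2 * q + 1) * (exp 2 ^ (q + 2) / 2 * towerFO D (κ ^ 2) N (q + 1))) := by
  have hε : 0 ≤ imagTimeWeight β M := imagTimeWeight_nonneg hβ.le M
  have hτ0 : 0 ≤ τ := le_trans (by positivity) hτ1
  have hψ0 : 0 ≤ ψ := le_trans (by positivity) hψ1
  have hRHS : 0 ≤ imagTimeWeight β M ^ (2 * q + 1) *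
      (cr * cc ^ (2 * q + 1) *
          (∑ n ∈ Icc 2 (N₀ - 1), exp 1 * (exp 1 * α / κ ^ 2) ^ (n - 1) * ψ ^ (q + 1) * towerS D τ N n (q + 1) +
            ψ ^ (q + 1) * (exp 1 * towerV D τ N * (exp 1 * α / κ ^ 2 * towerV D τ N) ^ (N₀ - 1) / (1 - exp 1 * α / κ ^ 2 * towerV D τ N))) +
        cr * cc ^ (2 * q + 1) * (exp 2 ^ (q + 2) / 2 * towerFO D (κ ^ 2) N (q + 1))) := by
    have hFO0 : 0 ≤ towerFO D (κ ^ 2) N (q + 1) := towerFO_nonneg (by positivity) hN0 _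
    have hS0 : 0 ≤ ∑ n ∈ Icc 2 (N₀ - 1), exp 1 * (exp 1 * α / κ ^ 2) ^ (n - 1) * ψ ^ (q + 1) * towerS D τ N n (q + 1) :=
      sum_nonneg fun n _ => by have := towerS_nonneg (D := D) hτ0 hN0 n (q + 1); positivity
    have hT0 : 0 ≤ ψ ^ (q + 1) * (exp 1 * towerV D τ N * (exp 1 * α / κ ^ 2 * towerV D τ N) ^ (N₀ - 1) /
        (1 - exp 1 * α / κ ^ 2 * towerV D τ N)) := by
      have hV := towerV_nonneg (D := D) hτ0 hN0
      exact mul_nonneg (pow_nonneg hψ0 _) (div_nonneg (by positivity) (sub_nonneg.2 hguard.le))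
    positivity
  unfold klTowerBornLev
  rcases isEmpty_or_nonempty {Ωe : Fin (2 * (q + 1)) → Option (SectorLeg (sectorCount (d * k))) // levelCount Ωe = F} with h | h
  · rw [Real.iSup_of_isEmpty]; exact hRHS
  · refine ciSup_le fun Ωe => ?_
    exact klLevNormOf_klTowerIncr_le_kit (L := L) (M := M) hβ U μ K hd hk le_rfl hZ hκ hGB hα hrow hcol hρ hcr0 hcc0 hrow' hcol' hN₀ hN0 hN00 hNB hD
      hτ1 hτ2 hψ1 hψ2 hguard q Ωe.1

end Born

end Summit.HubbardSuperconductivity.HubbardSuperconductivity.Theorems.EngineV8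

end
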